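import Mathlib
import Summits.AtomisticToContinuum.FouriersLaw.Theorems.EmbeddedDrudeMourreDrudeDissolutionSecondDifferenceSmoothing
import Summits.AtomisticToContinuum.FouriersLaw.Theorems.EmbeddedDrudeMourreDrudeDissolutionCellCalculus
import HarnessLib

/-!
# Second differences of a pushforward from the period cell: the two-flux `O(δ²)` bound
(crux `EmbeddedDrudeMourre.DrudeDissolution`, item stmt-AtomisticToContinuum-12593; `--supports` file for the
registered sub-goal `cell_abs_integral_secondDiff_le` of stub B1b″ `stub_excursionSecondDifference` of line
`kinetic-polymer-gas-on-the-time-axis`; closes nothing; lead c13 (process B), 2026-08-17)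

WHAT. On the period cell `μc = (vol|(−π,π])^{⊗3}` of `ℝ × ℝ × ℝ` let `Ω` be a `C¹` level function and
`G` an amplitude, `Ω` being `2π`-periodic in each coordinate. A FLUX for `G` is a triple of periodic `C¹`
functions `Y = (Y₁,Y₂,Y₃)` with `Y₁∂₁Ω + Y₂∂₂Ω + Y₃∂₃Ω = G` (e.g. `Y = G ∇Ω/|∇Ω|²` where `∇Ω ≠ 0` on the
support of `G`, or `Y = (G/∂_vΩ) v` for a transversal coordinate direction `v`); its divergence defines
the next amplitude `L†G := −(∂₁Y₁ + ∂₂Y₂ + ∂₃Y₃)`.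
* `cell_integral_deriv_comp_mul_eq` — ONE integration by parts along the flux: for a `C¹` pair
  `Ψ' = dΨ/dE`, `∫ Ψ'(Ω)·G dμc = ∫ Ψ(Ω)·(L†G) dμc` (no boundary terms on the torus:
  `cell_integral_mul_fderiv_eq_neg`).
* `cell_abs_integral_secondDiff_le` — TWO of them: given a flux `Y` for `G` and a flux `Y'` for `L†G`,
  for every continuous test function `|φ| ≤ 1` and `δ ≥ 0`,
  `|∫ G·(2φ(Ω) − φ(Ω+δ) − φ(Ω−δ)) dμc| ≤ δ² ∫ |∂₁Y'₁ + ∂₂Y'₂ + ∂₃Y'₃| dμc`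
  (the constant sees no derivative of `φ`; `exists_smoothed_secondDiff` supplies `Φ` with `Φ″ =` the
  second difference of `φ` and `|Φ| ≤ δ²`).

WHY (role). This is the `O(δ²)` engine of B1b″ on the cell itself: with `G = W·χ` (`W` the
bracket-weighted two-phonon weight, `χ` a periodic cutoff vanishing near the critical set of `Ω`) and the
gradient flux, the right-hand side is `δ²∫|L†L†(Wχ)|`, to be estimated by power counting in the distance
to the critical set (the dyadic part of B1b″); the discarded piece `W·(1−χ)` is bounded trivially by
`4∫W(1−χ)`.
-/

noncomputable section

open MeasureTheory Set Filter Function Topology Real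
open scoped Topology ContDiff

namespace Summit.AtomisticToContinuum.FouriersLaw.Theorems.DrudeDissolution.KineticPolymerGasOnTheTimeAxis

/-! ### §2 One integration by parts along a flux -/

/-- A `C¹` pair on the line is `C¹`: if `Ψ' = dΨ/dE` everywhere with `Ψ'` continuous then
`Ψ ∈ C¹`. [folklore] -/
theorem cell_contDiff_one_of_hasDerivAt {Ψ Ψ' : ℝ → ℝ} (hΨ : ∀ E, HasDerivAt Ψ (Ψ' E) E)
    (hΨ'c : Continuous Ψ') : ContDiff ℝ 1 Ψ := by
  rw [show (1 : WithTop ℕ∞) = 0 + 1 by rfl, contDiff_succ_iff_deriv]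
  refine ⟨fun E => (hΨ E).differentiableAt, by simp, ?_⟩
  have : deriv Ψ = Ψ' := funext fun E => (hΨ E).deriv
  rw [this]
  exact contDiff_zero.2 hΨ'c

/-- Chain rule: `∂ₑ (Ψ ∘ Ω) = Ψ'(Ω) ∂ₑΩ`. [folklore] -/
theorem cell_fderiv_comp_apply {Ψ Ψ' : ℝ → ℝ} (hΨ : ∀ E, HasDerivAt Ψ (Ψ' E) E)
    {Ω : ℝ × ℝ × ℝ → ℝ} (hΩ : Differentiable ℝ Ω) (p e : ℝ × ℝ × ℝ) :
    fderiv ℝ (fun q => Ψ (Ω q)) p e = Ψ' (Ω p) * fderiv ℝ Ω p e := by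
  have hc : HasFDerivAt (fun q => Ψ (Ω q)) (Ψ' (Ω p) • fderiv ℝ Ω p) p :=
    (hΨ (Ω p)).comp_hasFDerivAt p (hΩ p).hasFDerivAt
  rw [hc.fderiv]
  rfl

/-- **One integration by parts along a flux on the period cell.** For a `C¹` pair `Ψ' = dΨ/dE`, a `C¹`
triply periodic level function `Ω`, an amplitude `G` and `C¹` triply periodic fluxes `Y₁, Y₂, Y₃` with
`Y₁∂₁Ω + Y₂∂₂Ω + Y₃∂₃Ω = G`:
`∫ Ψ'(Ω)·G dμc = −∫ Ψ(Ω)·(∂₁Y₁ + ∂₂Y₂ + ∂₃Y₃) dμc`. [folklore] -/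
theorem cell_integral_deriv_comp_mul_eq {Ψ Ψ' : ℝ → ℝ} (hΨ : ∀ E, HasDerivAt Ψ (Ψ' E) E)
    (hΨ'c : Continuous Ψ') {Ω G Y₁ Y₂ Y₃ : ℝ × ℝ × ℝ → ℝ} (hΩ : ContDiff ℝ 1 Ω)
    (hΩp₁ : ∀ p : ℝ × ℝ × ℝ, Ω (p.1 + 2 * π, p.2.1, p.2.2) = Ω p)
    (hΩp₂ : ∀ p : ℝ × ℝ × ℝ, Ω (p.1, p.2.1 + 2 * π, p.2.2) = Ω p)
    (hΩp₃ : ∀ p : ℝ × ℝ × ℝ, Ω (p.1, p.2.1, p.2.2 + 2 * π) = Ω p)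
    (hY₁ : ContDiff ℝ 1 Y₁) (hY₂ : ContDiff ℝ 1 Y₂) (hY₃ : ContDiff ℝ 1 Y₃)
    (hY₁p₁ : ∀ p : ℝ × ℝ × ℝ, Y₁ (p.1 + 2 * π, p.2.1, p.2.2) = Y₁ p)
    (hY₁p₂ : ∀ p : ℝ × ℝ × ℝ, Y₁ (p.1, p.2.1 + 2 * π, p.2.2) = Y₁ p)
    (hY₁p₃ : ∀ p : ℝ × ℝ × ℝ, Y₁ (p.1, p.2.1, p.2.2 + 2 * π) = Y₁ p)
    (hY₂p₁ : ∀ p : ℝ × ℝ × ℝ, Y₂ (p.1 + 2 * π, p.2.1, p.2.2) = Y₂ p)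
    (hY₂p₂ : ∀ p : ℝ × ℝ × ℝ, Y₂ (p.1, p.2.1 + 2 * π, p.2.2) = Y₂ p)
    (hY₂p₃ : ∀ p : ℝ × ℝ × ℝ, Y₂ (p.1, p.2.1, p.2.2 + 2 * π) = Y₂ p)
    (hY₃p₁ : ∀ p : ℝ × ℝ × ℝ, Y₃ (p.1 + 2 * π, p.2.1, p.2.2) = Y₃ p)
    (hY₃p₂ : ∀ p : ℝ × ℝ × ℝ, Y₃ (p.1, p.2.1 + 2 * π, p.2.2) = Y₃ p)
    (hY₃p₃ : ∀ p : ℝ × ℝ × ℝ, Y₃ (p.1, p.2.1, p.2.2 + 2 * π) = Y₃ p)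
    (hflux : ∀ p, Y₁ p * fderiv ℝ Ω p (1, 0, 0) + Y₂ p * fderiv ℝ Ω p (0, 1, 0) +
      Y₃ p * fderiv ℝ Ω p (0, 0, 1) = G p) :
    ∫ p, Ψ' (Ω p) * G p ∂((volume.restrict (Set.Ioc (-Real.pi) Real.pi)).prod ((volume.restrict (Set.Ioc (-Real.pi) Real.pi)).prod (volume.restrict (Set.Ioc (-Real.pi) Real.pi)))) =
      -∫ p, Ψ (Ω p) * (fderiv ℝ Y₁ p (1, 0, 0) + fderiv ℝ Y₂ p (0, 1, 0) + fderiv ℝ Y₃ p (0, 0, 1)) ∂((volume.restrict (Set.Ioc (-Real.pi) Real.pi)).prod ((volume.restrict (Set.Ioc (-Real.pi) Real.pi)).prod (volume.restrict (Set.Ioc (-Real.pi) Real.pi)))) := by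
  have hΨ1 : ContDiff ℝ 1 Ψ := cell_contDiff_one_of_hasDerivAt hΨ hΨ'c
  have hΨc : Continuous Ψ := hΨ1.continuous
  have hΩd : Differentiable ℝ Ω := hΩ.differentiable one_ne_zero
  set g : ℝ × ℝ × ℝ → ℝ := fun q => Ψ (Ω q) with hg
  have hg1 : ContDiff ℝ 1 g := hΨ1.comp hΩ
  have hgp₁ : ∀ p : ℝ × ℝ × ℝ, g (p.1 + 2 * π, p.2.1, p.2.2) = g p := fun p => by
    simp only [hg, hΩp₁ p]
  have hgp₂ : ∀ p : ℝ × ℝ × ℝ, g (p.1, p.2.1 + 2 * π, p.2.2) = g p := fun p => by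
    simp only [hg, hΩp₂ p]
  have hgp₃ : ∀ p : ℝ × ℝ × ℝ, g (p.1, p.2.1, p.2.2 + 2 * π) = g p := fun p => by
    simp only [hg, hΩp₃ p]
  have hg' : ∀ p e, fderiv ℝ g p e = Ψ' (Ω p) * fderiv ℝ Ω p e := fun p e =>
    cell_fderiv_comp_apply hΨ hΩd p e
  -- the three integrations by parts
  have h1 := cell_integral_mul_fderiv_eq_neg Y₁ g hY₁ hg1 hY₁p₁ hY₁p₂ hY₁p₃ hgp₁ hgp₂ hgp₃
    (1, 0, 0) (Or.inl rfl)
  have h2 := cell_integral_mul_fderiv_eq_neg Y₂ g hY₂ hg1 hY₂p₁ hY₂p₂ hY₂p₃ hgp₁ hgp₂ hgp₃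
    (0, 1, 0) (Or.inr (Or.inl rfl))
  have h3 := cell_integral_mul_fderiv_eq_neg Y₃ g hY₃ hg1 hY₃p₁ hY₃p₂ hY₃p₃ hgp₁ hgp₂ hgp₃
    (0, 0, 1) (Or.inr (Or.inr rfl))
  -- continuity (hence integrability on the cell) of everything in sight
  have hY₁' : Continuous fun p => fderiv ℝ Y₁ p (1, 0, 0) :=
    (hY₁.continuous_fderiv one_ne_zero).clm_apply continuous_const
  have hY₂' : Continuous fun p => fderiv ℝ Y₂ p (0, 1, 0) :=
    (hY₂.continuous_fderiv one_ne_zero).clm_apply continuous_const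
  have hY₃' : Continuous fun p => fderiv ℝ Y₃ p (0, 0, 1) :=
    (hY₃.continuous_fderiv one_ne_zero).clm_apply continuous_const
  have hgd' : ∀ e, Continuous fun p => fderiv ℝ g p e := fun e =>
    (hg1.continuous_fderiv one_ne_zero).clm_apply continuous_const
  have hI : ∀ {F : ℝ × ℝ × ℝ → ℝ}, Continuous F → Integrable F ((volume.restrict (Set.Ioc (-Real.pi) Real.pi)).prod ((volume.restrict (Set.Ioc (-Real.pi) Real.pi)).prod (volume.restrict (Set.Ioc (-Real.pi) Real.pi)))) := fun hF =>
    MourreDissolution.levelShift_integrable_cell hF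
  -- `Ψ'(Ω) G = Σⱼ Yⱼ ∂ⱼ g`
  have i1 : Integrable (fun p => Y₁ p * fderiv ℝ g p (1, 0, 0)) ((volume.restrict (Set.Ioc (-Real.pi) Real.pi)).prod ((volume.restrict (Set.Ioc (-Real.pi) Real.pi)).prod (volume.restrict (Set.Ioc (-Real.pi) Real.pi)))) := hI (hY₁.continuous.mul (hgd' _))
  have i2 : Integrable (fun p => Y₂ p * fderiv ℝ g p (0, 1, 0)) ((volume.restrict (Set.Ioc (-Real.pi) Real.pi)).prod ((volume.restrict (Set.Ioc (-Real.pi) Real.pi)).prod (volume.restrict (Set.Ioc (-Real.pi) Real.pi)))) := hI (hY₂.continuous.mul (hgd' _))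
  have i3 : Integrable (fun p => Y₃ p * fderiv ℝ g p (0, 0, 1)) ((volume.restrict (Set.Ioc (-Real.pi) Real.pi)).prod ((volume.restrict (Set.Ioc (-Real.pi) Real.pi)).prod (volume.restrict (Set.Ioc (-Real.pi) Real.pi)))) := hI (hY₃.continuous.mul (hgd' _))
  have j1 : Integrable (fun p => fderiv ℝ Y₁ p (1, 0, 0) * g p) ((volume.restrict (Set.Ioc (-Real.pi) Real.pi)).prod ((volume.restrict (Set.Ioc (-Real.pi) Real.pi)).prod (volume.restrict (Set.Ioc (-Real.pi) Real.pi)))) := hI (hY₁'.mul hg1.continuous)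
  have j2 : Integrable (fun p => fderiv ℝ Y₂ p (0, 1, 0) * g p) ((volume.restrict (Set.Ioc (-Real.pi) Real.pi)).prod ((volume.restrict (Set.Ioc (-Real.pi) Real.pi)).prod (volume.restrict (Set.Ioc (-Real.pi) Real.pi)))) := hI (hY₂'.mul hg1.continuous)
  have j3 : Integrable (fun p => fderiv ℝ Y₃ p (0, 0, 1) * g p) ((volume.restrict (Set.Ioc (-Real.pi) Real.pi)).prod ((volume.restrict (Set.Ioc (-Real.pi) Real.pi)).prod (volume.restrict (Set.Ioc (-Real.pi) Real.pi)))) := hI (hY₃'.mul hg1.continuous)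
  have hlhs : ∫ p, Ψ' (Ω p) * G p ∂((volume.restrict (Set.Ioc (-Real.pi) Real.pi)).prod ((volume.restrict (Set.Ioc (-Real.pi) Real.pi)).prod (volume.restrict (Set.Ioc (-Real.pi) Real.pi)))) = ∫ p, (Y₁ p * fderiv ℝ g p (1, 0, 0) +
      Y₂ p * fderiv ℝ g p (0, 1, 0) + Y₃ p * fderiv ℝ g p (0, 0, 1)) ∂((volume.restrict (Set.Ioc (-Real.pi) Real.pi)).prod ((volume.restrict (Set.Ioc (-Real.pi) Real.pi)).prod (volume.restrict (Set.Ioc (-Real.pi) Real.pi)))) := by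
    refine integral_congr_ae (Eventually.of_forall fun p => ?_)
    simp only [hg', ← hflux p]
    ring
  have hrhs : ∫ p, Ψ (Ω p) * (fderiv ℝ Y₁ p (1, 0, 0) + fderiv ℝ Y₂ p (0, 1, 0) +
      fderiv ℝ Y₃ p (0, 0, 1)) ∂((volume.restrict (Set.Ioc (-Real.pi) Real.pi)).prod ((volume.restrict (Set.Ioc (-Real.pi) Real.pi)).prod (volume.restrict (Set.Ioc (-Real.pi) Real.pi)))) = ∫ p, (fderiv ℝ Y₁ p (1, 0, 0) * g p +
        fderiv ℝ Y₂ p (0, 1, 0) * g p + fderiv ℝ Y₃ p (0, 0, 1) * g p) ∂((volume.restrict (Set.Ioc (-Real.pi) Real.pi)).prod ((volume.restrict (Set.Ioc (-Real.pi) Real.pi)).prod (volume.restrict (Set.Ioc (-Real.pi) Real.pi)))) := by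
    refine integral_congr_ae (Eventually.of_forall fun p => ?_)
    simp only [hg]
    ring
  have i12 : Integrable (fun p => Y₁ p * fderiv ℝ g p (1, 0, 0) + Y₂ p * fderiv ℝ g p (0, 1, 0)) ((volume.restrict (Set.Ioc (-Real.pi) Real.pi)).prod ((volume.restrict (Set.Ioc (-Real.pi) Real.pi)).prod (volume.restrict (Set.Ioc (-Real.pi) Real.pi)))) :=
    i1.add i2
  have j12 : Integrable (fun p => fderiv ℝ Y₁ p (1, 0, 0) * g p + fderiv ℝ Y₂ p (0, 1, 0) * g p) ((volume.restrict (Set.Ioc (-Real.pi) Real.pi)).prod ((volume.restrict (Set.Ioc (-Real.pi) Real.pi)).prod (volume.restrict (Set.Ioc (-Real.pi) Real.pi)))) :=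
    j1.add j2
  have e1 : ∫ p, (Y₁ p * fderiv ℝ g p (1, 0, 0) + Y₂ p * fderiv ℝ g p (0, 1, 0) +
      Y₃ p * fderiv ℝ g p (0, 0, 1)) ∂((volume.restrict (Set.Ioc (-Real.pi) Real.pi)).prod ((volume.restrict (Set.Ioc (-Real.pi) Real.pi)).prod (volume.restrict (Set.Ioc (-Real.pi) Real.pi)))) = (∫ p, (Y₁ p * fderiv ℝ g p (1, 0, 0) +
        Y₂ p * fderiv ℝ g p (0, 1, 0)) ∂((volume.restrict (Set.Ioc (-Real.pi) Real.pi)).prod ((volume.restrict (Set.Ioc (-Real.pi) Real.pi)).prod (volume.restrict (Set.Ioc (-Real.pi) Real.pi))))) + ∫ p, Y₃ p * fderiv ℝ g p (0, 0, 1) ∂((volume.restrict (Set.Ioc (-Real.pi) Real.pi)).prod ((volume.restrict (Set.Ioc (-Real.pi) Real.pi)).prod (volume.restrict (Set.Ioc (-Real.pi) Real.pi)))) :=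
    integral_add i12 i3
  have e2 : ∫ p, (Y₁ p * fderiv ℝ g p (1, 0, 0) + Y₂ p * fderiv ℝ g p (0, 1, 0)) ∂((volume.restrict (Set.Ioc (-Real.pi) Real.pi)).prod ((volume.restrict (Set.Ioc (-Real.pi) Real.pi)).prod (volume.restrict (Set.Ioc (-Real.pi) Real.pi)))) =
      (∫ p, Y₁ p * fderiv ℝ g p (1, 0, 0) ∂((volume.restrict (Set.Ioc (-Real.pi) Real.pi)).prod ((volume.restrict (Set.Ioc (-Real.pi) Real.pi)).prod (volume.restrict (Set.Ioc (-Real.pi) Real.pi))))) + ∫ p, Y₂ p * fderiv ℝ g p (0, 1, 0) ∂((volume.restrict (Set.Ioc (-Real.pi) Real.pi)).prod ((volume.restrict (Set.Ioc (-Real.pi) Real.pi)).prod (volume.restrict (Set.Ioc (-Real.pi) Real.pi)))) :=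
    integral_add i1 i2
  have e3 : ∫ p, (fderiv ℝ Y₁ p (1, 0, 0) * g p + fderiv ℝ Y₂ p (0, 1, 0) * g p +
      fderiv ℝ Y₃ p (0, 0, 1) * g p) ∂((volume.restrict (Set.Ioc (-Real.pi) Real.pi)).prod ((volume.restrict (Set.Ioc (-Real.pi) Real.pi)).prod (volume.restrict (Set.Ioc (-Real.pi) Real.pi)))) = (∫ p, (fderiv ℝ Y₁ p (1, 0, 0) * g p +
        fderiv ℝ Y₂ p (0, 1, 0) * g p) ∂((volume.restrict (Set.Ioc (-Real.pi) Real.pi)).prod ((volume.restrict (Set.Ioc (-Real.pi) Real.pi)).prod (volume.restrict (Set.Ioc (-Real.pi) Real.pi))))) + ∫ p, fderiv ℝ Y₃ p (0, 0, 1) * g p ∂((volume.restrict (Set.Ioc (-Real.pi) Real.pi)).prod ((volume.restrict (Set.Ioc (-Real.pi) Real.pi)).prod (volume.restrict (Set.Ioc (-Real.pi) Real.pi)))) :=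
    integral_add j12 j3
  have e4 : ∫ p, (fderiv ℝ Y₁ p (1, 0, 0) * g p + fderiv ℝ Y₂ p (0, 1, 0) * g p) ∂((volume.restrict (Set.Ioc (-Real.pi) Real.pi)).prod ((volume.restrict (Set.Ioc (-Real.pi) Real.pi)).prod (volume.restrict (Set.Ioc (-Real.pi) Real.pi)))) =
      (∫ p, fderiv ℝ Y₁ p (1, 0, 0) * g p ∂((volume.restrict (Set.Ioc (-Real.pi) Real.pi)).prod ((volume.restrict (Set.Ioc (-Real.pi) Real.pi)).prod (volume.restrict (Set.Ioc (-Real.pi) Real.pi))))) + ∫ p, fderiv ℝ Y₂ p (0, 1, 0) * g p ∂((volume.restrict (Set.Ioc (-Real.pi) Real.pi)).prod ((volume.restrict (Set.Ioc (-Real.pi) Real.pi)).prod (volume.restrict (Set.Ioc (-Real.pi) Real.pi)))) :=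
    integral_add j1 j2
  rw [hlhs, hrhs, e1, e2, e3, e4, h1, h2, h3]
  ring

/-! ### §3 Two integrations by parts: the second-difference bound on the cell -/

/-- **Second differences of a pushforward from the period cell are `O(δ²)` (registered sub-goal
`cell_abs_integral_secondDiff_le` of stub B1b″; all binders explicit).** On the cell `(vol|(−π,π])^{⊗3}`,
for a `C¹` triply `2π`-periodic level function `Ω`, an amplitude `G`, `C¹` triply periodic fluxes
`Y₁,Y₂,Y₃` for `G` (`ΣYⱼ∂ⱼΩ = G`) and `Y'₁,Y'₂,Y'₃` for `L†G = −Σ∂ⱼYⱼ` (`ΣY'ⱼ∂ⱼΩ = −Σ∂ⱼYⱼ`), every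
continuous test function `|φ| ≤ 1` and `δ ≥ 0`:
`|∫ G·(2φ(Ω) − φ(Ω+δ) − φ(Ω−δ)) dμc| ≤ δ²·∫ |∂₁Y'₁ + ∂₂Y'₂ + ∂₃Y'₃| dμc`.
[cite: HormanderALPDO1, Thm. 7.7.1] -/
theorem cell_abs_integral_secondDiff_le :
    ∀ (Ω G Y₁ Y₂ Y₃ Y'₁ Y'₂ Y'₃ : ℝ × ℝ × ℝ → ℝ) (φ : ℝ → ℝ) (δ : ℝ),
      ContDiff ℝ 1 Ω →
      (∀ p : ℝ × ℝ × ℝ, Ω (p.1 + 2 * Real.pi, p.2.1, p.2.2) = Ω p) →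
      (∀ p : ℝ × ℝ × ℝ, Ω (p.1, p.2.1 + 2 * Real.pi, p.2.2) = Ω p) →
      (∀ p : ℝ × ℝ × ℝ, Ω (p.1, p.2.1, p.2.2 + 2 * Real.pi) = Ω p) →
      ContDiff ℝ 1 Y₁ → ContDiff ℝ 1 Y₂ → ContDiff ℝ 1 Y₃ →
      (∀ p : ℝ × ℝ × ℝ, Y₁ (p.1 + 2 * Real.pi, p.2.1, p.2.2) = Y₁ p) →
      (∀ p : ℝ × ℝ × ℝ, Y₁ (p.1, p.2.1 + 2 * Real.pi, p.2.2) = Y₁ p) →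
      (∀ p : ℝ × ℝ × ℝ, Y₁ (p.1, p.2.1, p.2.2 + 2 * Real.pi) = Y₁ p) →
      (∀ p : ℝ × ℝ × ℝ, Y₂ (p.1 + 2 * Real.pi, p.2.1, p.2.2) = Y₂ p) →
      (∀ p : ℝ × ℝ × ℝ, Y₂ (p.1, p.2.1 + 2 * Real.pi, p.2.2) = Y₂ p) →
      (∀ p : ℝ × ℝ × ℝ, Y₂ (p.1, p.2.1, p.2.2 + 2 * Real.pi) = Y₂ p) →
      (∀ p : ℝ × ℝ × ℝ, Y₃ (p.1 + 2 * Real.pi, p.2.1, p.2.2) = Y₃ p) →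
      (∀ p : ℝ × ℝ × ℝ, Y₃ (p.1, p.2.1 + 2 * Real.pi, p.2.2) = Y₃ p) →
      (∀ p : ℝ × ℝ × ℝ, Y₃ (p.1, p.2.1, p.2.2 + 2 * Real.pi) = Y₃ p) →
      ContDiff ℝ 1 Y'₁ → ContDiff ℝ 1 Y'₂ → ContDiff ℝ 1 Y'₃ →
      (∀ p : ℝ × ℝ × ℝ, Y'₁ (p.1 + 2 * Real.pi, p.2.1, p.2.2) = Y'₁ p) →
      (∀ p : ℝ × ℝ × ℝ, Y'₁ (p.1, p.2.1 + 2 * Real.pi, p.2.2) = Y'₁ p) →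
      (∀ p : ℝ × ℝ × ℝ, Y'₁ (p.1, p.2.1, p.2.2 + 2 * Real.pi) = Y'₁ p) →
      (∀ p : ℝ × ℝ × ℝ, Y'₂ (p.1 + 2 * Real.pi, p.2.1, p.2.2) = Y'₂ p) →
      (∀ p : ℝ × ℝ × ℝ, Y'₂ (p.1, p.2.1 + 2 * Real.pi, p.2.2) = Y'₂ p) →
      (∀ p : ℝ × ℝ × ℝ, Y'₂ (p.1, p.2.1, p.2.2 + 2 * Real.pi) = Y'₂ p) →
      (∀ p : ℝ × ℝ × ℝ, Y'₃ (p.1 + 2 * Real.pi, p.2.1, p.2.2) = Y'₃ p) →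
      (∀ p : ℝ × ℝ × ℝ, Y'₃ (p.1, p.2.1 + 2 * Real.pi, p.2.2) = Y'₃ p) →
      (∀ p : ℝ × ℝ × ℝ, Y'₃ (p.1, p.2.1, p.2.2 + 2 * Real.pi) = Y'₃ p) →
      (∀ p, Y₁ p * fderiv ℝ Ω p (1, 0, 0) + Y₂ p * fderiv ℝ Ω p (0, 1, 0) +
        Y₃ p * fderiv ℝ Ω p (0, 0, 1) = G p) →
      (∀ p, Y'₁ p * fderiv ℝ Ω p (1, 0, 0) + Y'₂ p * fderiv ℝ Ω p (0, 1, 0) +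
        Y'₃ p * fderiv ℝ Ω p (0, 0, 1) =
          -(fderiv ℝ Y₁ p (1, 0, 0) + fderiv ℝ Y₂ p (0, 1, 0) + fderiv ℝ Y₃ p (0, 0, 1))) →
      Continuous φ → (∀ x, |φ x| ≤ 1) → 0 ≤ δ →
      |∫ p, G p * (2 * φ (Ω p) - φ (Ω p + δ) - φ (Ω p - δ))
          ∂((volume.restrict (Set.Ioc (-Real.pi) Real.pi)).prod
            ((volume.restrict (Set.Ioc (-Real.pi) Real.pi)).prod
              (volume.restrict (Set.Ioc (-Real.pi) Real.pi))))| ≤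
        δ ^ 2 * ∫ p, |fderiv ℝ Y'₁ p (1, 0, 0) + fderiv ℝ Y'₂ p (0, 1, 0) + fderiv ℝ Y'₃ p (0, 0, 1)|
          ∂((volume.restrict (Set.Ioc (-Real.pi) Real.pi)).prod
            ((volume.restrict (Set.Ioc (-Real.pi) Real.pi)).prod
              (volume.restrict (Set.Ioc (-Real.pi) Real.pi)))) := by
  intro Ω G Y₁ Y₂ Y₃ Y'₁ Y'₂ Y'₃ φ δ hΩ hΩp₁ hΩp₂ hΩp₃ hY₁ hY₂ hY₃ hY₁p₁ hY₁p₂ hY₁p₃ hY₂p₁ hY₂p₂ hY₂p₃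
    hY₃p₁ hY₃p₂ hY₃p₃ hY'₁ hY'₂ hY'₃ hY'₁p₁ hY'₁p₂ hY'₁p₃ hY'₂p₁ hY'₂p₂ hY'₂p₃ hY'₃p₁ hY'₃p₂ hY'₃p₃
    hflux hflux' hφ hφ1 hδ
  -- the twice-integrated test function
  obtain ⟨Φ, Φ₁, Φ₂, hΦd, hΦ₁d, hΦ₂c, hΦ₂eq, hΦb'⟩ := exists_smoothed_secondDiff φ δ hφ hδ
  have hΦb : ∀ E, |Φ E| ≤ δ ^ 2 := hΦb' hφ1
  have hΦ₁c : Continuous Φ₁ := continuous_iff_continuousAt.2 fun E => (hΦ₁d E).continuousAt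
  have hΦc : Continuous Φ := continuous_iff_continuousAt.2 fun E => (hΦd E).continuousAt
  -- the level-1 divergence is continuous
  have hY₁' : Continuous fun p => fderiv ℝ Y₁ p (1, 0, 0) :=
    (hY₁.continuous_fderiv one_ne_zero).clm_apply continuous_const
  have hY₂' : Continuous fun p => fderiv ℝ Y₂ p (0, 1, 0) :=
    (hY₂.continuous_fderiv one_ne_zero).clm_apply continuous_const
  have hY₃' : Continuous fun p => fderiv ℝ Y₃ p (0, 0, 1) :=
    (hY₃.continuous_fderiv one_ne_zero).clm_apply continuous_const
  have hY'₁' : Continuous fun p => fderiv ℝ Y'₁ p (1, 0, 0) :=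
    (hY'₁.continuous_fderiv one_ne_zero).clm_apply continuous_const
  have hY'₂' : Continuous fun p => fderiv ℝ Y'₂ p (0, 1, 0) :=
    (hY'₂.continuous_fderiv one_ne_zero).clm_apply continuous_const
  have hY'₃' : Continuous fun p => fderiv ℝ Y'₃ p (0, 0, 1) :=
    (hY'₃.continuous_fderiv one_ne_zero).clm_apply continuous_const
  -- first integration by parts: `∫ Φ₂(Ω) G = −∫ Φ₁(Ω) Σ∂Y`
  have hstep1 := cell_integral_deriv_comp_mul_eq hΦ₁d hΦ₂c hΩ hΩp₁ hΩp₂ hΩp₃ hY₁ hY₂ hY₃ hY₁p₁ hY₁p₂ hY₁p₃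
    hY₂p₁ hY₂p₂ hY₂p₃ hY₃p₁ hY₃p₂ hY₃p₃ hflux
  -- second integration by parts: `∫ Φ₁(Ω) (−Σ∂Y) = −∫ Φ(Ω) Σ∂Y'`
  have hstep2 := cell_integral_deriv_comp_mul_eq hΦd hΦ₁c hΩ hΩp₁ hΩp₂ hΩp₃ hY'₁ hY'₂ hY'₃ hY'₁p₁ hY'₁p₂
    hY'₁p₃ hY'₂p₁ hY'₂p₂ hY'₂p₃ hY'₃p₁ hY'₃p₂ hY'₃p₃ hflux'
  -- the left-hand side is `−∫ Φ₂(Ω) G`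
  have hlhs : ∫ p, G p * (2 * φ (Ω p) - φ (Ω p + δ) - φ (Ω p - δ)) ∂((volume.restrict (Set.Ioc (-Real.pi) Real.pi)).prod ((volume.restrict (Set.Ioc (-Real.pi) Real.pi)).prod (volume.restrict (Set.Ioc (-Real.pi) Real.pi)))) = -∫ p, Φ₂ (Ω p) * G p ∂((volume.restrict (Set.Ioc (-Real.pi) Real.pi)).prod ((volume.restrict (Set.Ioc (-Real.pi) Real.pi)).prod (volume.restrict (Set.Ioc (-Real.pi) Real.pi)))) := by
    rw [← integral_neg]
    refine integral_congr_ae (Eventually.of_forall fun p => ?_)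
    simp only [hΦ₂eq]
    ring
  have hmid : ∫ p, Φ₁ (Ω p) * (fderiv ℝ Y₁ p (1, 0, 0) + fderiv ℝ Y₂ p (0, 1, 0) +
      fderiv ℝ Y₃ p (0, 0, 1)) ∂((volume.restrict (Set.Ioc (-Real.pi) Real.pi)).prod ((volume.restrict (Set.Ioc (-Real.pi) Real.pi)).prod (volume.restrict (Set.Ioc (-Real.pi) Real.pi)))) = -∫ p, Φ₁ (Ω p) * -(fderiv ℝ Y₁ p (1, 0, 0) +
        fderiv ℝ Y₂ p (0, 1, 0) + fderiv ℝ Y₃ p (0, 0, 1)) ∂((volume.restrict (Set.Ioc (-Real.pi) Real.pi)).prod ((volume.restrict (Set.Ioc (-Real.pi) Real.pi)).prod (volume.restrict (Set.Ioc (-Real.pi) Real.pi)))) := by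
    rw [← integral_neg]
    refine integral_congr_ae (Eventually.of_forall fun p => ?_)
    simp only
    ring
  rw [hlhs, hstep1, neg_neg, hmid, hstep2, neg_neg]
  -- `|∫ Φ(Ω) Σ∂Y'| ≤ δ² ∫ |Σ∂Y'|`
  set Q : ℝ × ℝ × ℝ → ℝ := fun p => fderiv ℝ Y'₁ p (1, 0, 0) + fderiv ℝ Y'₂ p (0, 1, 0) +
    fderiv ℝ Y'₃ p (0, 0, 1) with hQdef
  have hQc : Continuous Q := (hY'₁'.add hY'₂').add hY'₃'
  have hQi : Integrable Q ((volume.restrict (Set.Ioc (-Real.pi) Real.pi)).prod ((volume.restrict (Set.Ioc (-Real.pi) Real.pi)).prod (volume.restrict (Set.Ioc (-Real.pi) Real.pi)))) := MourreDissolution.levelShift_integrable_cell hQc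
  calc |∫ p, Φ (Ω p) * Q p ∂((volume.restrict (Set.Ioc (-Real.pi) Real.pi)).prod ((volume.restrict (Set.Ioc (-Real.pi) Real.pi)).prod (volume.restrict (Set.Ioc (-Real.pi) Real.pi))))| ≤ ∫ p, |Φ (Ω p) * Q p| ∂((volume.restrict (Set.Ioc (-Real.pi) Real.pi)).prod ((volume.restrict (Set.Ioc (-Real.pi) Real.pi)).prod (volume.restrict (Set.Ioc (-Real.pi) Real.pi)))) := abs_integral_le_integral_abs
    _ ≤ ∫ p, δ ^ 2 * |Q p| ∂((volume.restrict (Set.Ioc (-Real.pi) Real.pi)).prod ((volume.restrict (Set.Ioc (-Real.pi) Real.pi)).prod (volume.restrict (Set.Ioc (-Real.pi) Real.pi)))) := by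
        refine integral_mono_of_nonneg (Eventually.of_forall fun p => abs_nonneg _)
          (hQi.abs.const_mul _) (Eventually.of_forall fun p => ?_)
        show |Φ (Ω p) * Q p| ≤ δ ^ 2 * |Q p|
        rw [abs_mul]
        exact mul_le_mul_of_nonneg_right (hΦb _) (abs_nonneg _)
    _ = δ ^ 2 * ∫ p, |Q p| ∂((volume.restrict (Set.Ioc (-Real.pi) Real.pi)).prod ((volume.restrict (Set.Ioc (-Real.pi) Real.pi)).prod (volume.restrict (Set.Ioc (-Real.pi) Real.pi)))) := integral_const_mul _ _

end Summit.AtomisticToContinuum.FouriersLaw.Theorems.DrudeDissolution.KineticPolymerGasOnTheTimeAxis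

end
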